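import Summits.FinalStateConjecture.FinalStateConjecture.Theorems.ZeroEnergyKerrOrBombErgoregionBombModTEvanescentSpecial
import Literature.Geometry.Lorentzian.StaticBlackHoleUniqueness

/-!
# `ErgoregionBombModT` — the stationary field is twist-free at every evanescent light point
# (crux stmt-FinalStateConjecture-17838, line `killing-light-points`, lead c4)

Route `ZeroEnergyKerrOrBomb` of the Final State Conjecture, crux
`Summit.FinalStateConjecture.FinalStateConjecture.Theses.ZeroEnergyKerrOrBomb.ErgoregionBombModT`,
line `killing-light-points`, skeleton v4 (`crux ⟺ OffWallBomb ∧ LightPointBomb`, p139708).  The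
EVANESCENT species of `LightPointBomb` (the stationary field `T` causal on the whole d.o.c. and null
at one of its points — where the crux demands a bomb of a hole without ergoregion, p141962) was
shown in `…EvanescentSpecial.lean` (p144151) to be algebraically special: at such a point `p`,
`∇T(p) = T♭ ∧ β♭` is a null bivector and `T(p)` is a repeated principal null direction.  This file
draws the consequence that speaks the language of the uniqueness theorems: **at an evanescent light
point the Frobenius 3-form of `T` vanishes, `T♭ ∧ dT♭ (p) = 0`** — `T` is hypersurface-orthogonal
("static") to first order exactly there (`PseudoRiemannianMetric.twistForm`,
`IsHypersurfaceOrthogonalOn`, the predicate concluded by `SudarskyWald1993_staticity`).  Indeed for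
a Killing field `dT♭(v, w) = g(∇_v T, w) - g(∇_w T, v) = 2 g(∇_v T, w) = 2 (T♭ ∧ β♭)(v, w)`, and
`T♭ ∧ T♭ ∧ β♭ = 0`.

So the light sheet of B's evanescent species lies in the zero set of the twist of `T` — for a
rotating hole (twist `≢ 0` on the d.o.c.) a further closed condition on top of `g(T,T) = 0`,
`d g(T,T) = 0`, `Ψ₀ = Ψ₁ = 0`; and on a hole whose `T` is twist-free on the whole d.o.c. (static
d.o.c.) the species is excluded outright by the static uniqueness theorem (Chruściel–Galloway 2010:
the d.o.c. is Schwarzschild, `T` timelike there).  Registered certificate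
`evanescentLightPoint_twistForm_eq_zero` of crux stmt-FinalStateConjecture-17838 (a certificate,
not an obligation of the skeleton).

References: R. M. Wald, *General Relativity* (1984), §7.1, (7.1.1), App. B.3; B. O'Neill,
*Semi-Riemannian geometry* (1983), Ch. 9, Prop. 9.25; D. Sudarsky, R. M. Wald, Phys. Rev. D 47
(1993) R5209; P. T. Chruściel, G. J. Galloway, arXiv:1004.0513.
-/

noncomputable section

open Bundle Set Filter Function Module
open scoped Manifold Topology

-- summit = problem name (D-0017)
set_option linter.dupNamespace false

namespace Summit.FinalStateConjecture.FinalStateConjecture.Theorems.ErgoregionBombModT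

open Literature.Geometry.Lorentzian

section Twist

variable {𝓑 : StationaryAFBlackHole.{0}} [𝓑.metric.HasLeviCivita]

/-- **A Killing field whose covariant differential is a null bivector `T♭ ∧ β♭` at `p` is
twist-free at `p`.**  If `∇_v T = g(T, v) β - g(β, v) T` for all `v ∈ T_pM`, then
`(T♭ ∧ dT♭)_p = 0` (`PseudoRiemannianMetric.twistForm`): with `dT♭(v, w) = g(∇_v T, w) -
g(∇_w T, v) = 2 (g(T,v) g(β,w) - g(β,v) g(T,w))` the cyclic sum `T♭(u) dT♭(v,w) + …` cancels
identically.  Wald 1984, §7.1, (7.1.1). [cite: Wald1984, §7.1 (7.1.1) and App. B.3] -/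
theorem twistForm_killing_eq_zero_of_leviCivita_eq_wedge {p : 𝓑.carrier}
    {β : TangentSpace (𝓡 4) p}
    (hA : ∀ v : TangentSpace (𝓡 4) p, 𝓑.metric.leviCivita 𝓑.killing p v =
      𝓑.metric.val p (𝓑.killing p) v • β - 𝓑.metric.val p β v • 𝓑.killing p)
    (u v w : TangentSpace (𝓡 4) p) : 𝓑.metric.twistForm 𝓑.killing p u v w = 0 := by
  simp only [PseudoRiemannianMetric.twistForm, hA u, hA v, hA w, map_sub, map_smul, sub_apply,
    FunLike.coe_smul, Pi.smul_apply, smul_eq_mul]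
  have s1 : 𝓑.metric.val p β u = 𝓑.metric.val p u β := 𝓑.metric.symm p β u
  have s2 : 𝓑.metric.val p β v = 𝓑.metric.val p v β := 𝓑.metric.symm p β v
  have s3 : 𝓑.metric.val p β w = 𝓑.metric.val p w β := 𝓑.metric.symm p β w
  have t1 : 𝓑.metric.val p (𝓑.killing p) u = 𝓑.metric.val p u (𝓑.killing p) :=
    𝓑.metric.symm p _ u
  have t2 : 𝓑.metric.val p (𝓑.killing p) v = 𝓑.metric.val p v (𝓑.killing p) :=
    𝓑.metric.symm p _ v
  have t3 : 𝓑.metric.val p (𝓑.killing p) w = 𝓑.metric.val p w (𝓑.killing p) :=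
    𝓑.metric.symm p _ w
  rw [s1, s2, s3, t1, t2, t3]
  ring

/-- **The stationary field is twist-free at every evanescent light point.**  At a local maximum
`p` of `g(T,T)` with `T(p)` null and non-zero and `Ric(T,T)(p) = 0`, `(T♭ ∧ dT♭)_p = 0`:
`∇T(p)` is the null bivector `T♭ ∧ β♭` (`wedge_and_repeatedPND_of_isLocalMax_of_null`, p144151)
and the previous lemma.  Equivalently `IsHypersurfaceOrthogonalOn T {p}` — the pointwise form of
the staticity predicate of Sudarsky–Wald 1993. [cite: Wald1984, §7.1 (7.1.1) and App. B.3] -/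
theorem twistForm_killing_eq_zero_of_isLocalMax_of_null {p : 𝓑.carrier}
    (hRic : 𝓑.metric.ricci p (𝓑.killing p) (𝓑.killing p) = 0)
    (hmax : IsLocalMax (fun y ↦ 𝓑.metric.val y (𝓑.killing y) (𝓑.killing y)) p)
    (hnull : 𝓑.metric.val p (𝓑.killing p) (𝓑.killing p) = 0) (hT0 : 𝓑.killing p ≠ 0)
    (u v w : TangentSpace (𝓡 4) p) : 𝓑.metric.twistForm 𝓑.killing p u v w = 0 := by
  obtain ⟨⟨β, -, hAβ⟩, -⟩ := wedge_and_repeatedPND_of_isLocalMax_of_null hRic hmax hnull hT0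
  exact twistForm_killing_eq_zero_of_leviCivita_eq_wedge hAβ u v w

/-- The same, phrased with the staticity predicate: `T` is hypersurface-orthogonal on `{p}`.
[cite: ChruscielCostaHeusler2012, §3.1] -/
theorem isHypersurfaceOrthogonalOn_singleton_of_isLocalMax_of_null {p : 𝓑.carrier}
    (hRic : 𝓑.metric.ricci p (𝓑.killing p) (𝓑.killing p) = 0)
    (hmax : IsLocalMax (fun y ↦ 𝓑.metric.val y (𝓑.killing y) (𝓑.killing y)) p)
    (hnull : 𝓑.metric.val p (𝓑.killing p) (𝓑.killing p) = 0) (hT0 : 𝓑.killing p ≠ 0) :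
    𝓑.metric.toPseudoRiemannianMetric.IsHypersurfaceOrthogonalOn 𝓑.killing {p} := by
  intro x hx
  rw [mem_singleton_iff] at hx
  subst hx
  exact twistForm_killing_eq_zero_of_isLocalMax_of_null hRic hmax hnull hT0

end Twist

/-- **The stationary field of a vacuum hole is twist-free at every evanescent light point**
(registered certificate `evanescentLightPoint_twistForm_eq_zero` of crux
stmt-FinalStateConjecture-17838 — a certificate, not an obligation of the skeleton): for a
Ricci-flat presentation with `T` causal on the whole d.o.c. and null and non-zero at `p ∈ ⟨⟨M_ext⟩⟩`,
`(T♭ ∧ dT♭)_p = 0`.  The light sheet of `LightPointBomb`'s evanescent species lies in the zero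
set of the twist of `T`. [cite: Wald1984, §7.1 (7.1.1) and App. B.3] -/
theorem evanescentLightPoint_twistForm_eq_zero :
    ∀ (𝓑 : Literature.Geometry.Lorentzian.StationaryAFBlackHole.{0}) [𝓑.metric.HasLeviCivita], 𝓑.metric.toPseudoRiemannianMetric.IsRicciFlat → (∀ x ∈ 𝓑.doc, 𝓑.metric.val x (𝓑.killing x) (𝓑.killing x) ≤ 0) → ∀ p ∈ 𝓑.doc, 𝓑.metric.val p (𝓑.killing p) (𝓑.killing p) = 0 → 𝓑.killing p ≠ 0 → ∀ u v w : TangentSpace (𝓡 4) p, 𝓑.metric.twistForm 𝓑.killing p u v w = 0 := by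
  intro 𝓑 _ hRic hcausal p hp hnull hT0 u v w
  have hR : 𝓑.metric.ricci p (𝓑.killing p) (𝓑.killing p) = 0 := by
    rw [show 𝓑.metric.ricci p = 0 from hRic p]; rfl
  exact twistForm_killing_eq_zero_of_isLocalMax_of_null hR
    (isLocalMax_val_killing_of_causal_of_null hcausal hp hnull) hnull hT0 u v w

end Summit.FinalStateConjecture.FinalStateConjecture.Theorems.ErgoregionBombModT

end
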